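import Summits.CriticalPhenomena.SAWScalingLimit.Theorems.MassRatio.Negative.Walks
import Summits.CriticalPhenomena.SAWScalingLimit.Theorems.SAWDefectDecoherenceMassRatioRenewalCut
import Literature.Probability.RandomPlanarGeometry.HexSAWLowerBound

/-!
# One-sided domain Markov property at a mid-edge: the occupation (two-leg fusion) inequality
(crux `MassRatio`, stmt-CriticalPhenomena-8550; STRATEGY-CENSUS §4.2 / §6 (E1))

For a finite hexagonal-lattice domain with vertex set `Λ`, boundary mid-edges `a, b ∈ ∂Ω` and any
mid-edge `e ≠ a, b`: a self-avoiding walk `γ ⊂ Ω : a → e` followed by a self-avoiding walk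
`ω : e → b` of the SLIT domain `Λ ∖ γ` (the vertices of `γ` deleted, so that `e` is a boundary
mid-edge of the slit domain) glue to a self-avoiding walk `a → b` of `Ω` whose vertex list is
`γ.verts ++ ω.verts` (`Occupation.glue`), and at a fixed `e` the gluing is injective
(`Occupation.glue_inj`: the cut point is the unique step of the glued walk through `e`). Hence, for
every fugacity `x ≥ 0`, the `x`-mass of the walks `a → b` FACTORISED AT `e`,
`Σ_{γ ⊂ Ω : a → e} x^{ℓ(γ)} · Σ_{ω ⊂ Ω∖γ : e → b} x^{ℓ(ω)}`, is at most `Σ_{Ω ⊂ Ω : a → b} x^{ℓ(Ω)}`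
(`sum_mul_sum_slit_le`), and summed over a finite set `S` of mid-edges it is at most
`|S| · Σ_{Ω : a → b} x^{ℓ(Ω)}` (`sum_sum_mul_sum_slit_le_card_mul`); in terms of the spin-`0`
parafermionic observable `Z = ‖F_{x,0}‖`:
`Σ_{e ∈ S} Σ_{γ : a → e} x^{ℓ(γ)} ‖F^{Λ∖γ}_{x,0}(e → b)‖ ≤ |S| · ‖F^{Λ}_{x,0}(a → b)‖`
(`occupation_le_card_mul_norm`). This is the "two-leg fusion / occupation" inequality of the
crux's strategy census (§4.2, read as `≤`; §6 (E1)): the left side is the mass of walks to `S`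
weighted by their tip-to-`b` continuation mass, the right side counts each walk `a → b` at most
once per step in `S`. Pure combinatorics of vertex lists (Duminil-Copin–Smirnov 2012 §2, walks
between mid-edges; Madras–Slade 1993 §1.2, concatenation); cut-, spin- and frame-independent.

Deliberately NOT here: the converse cut (surjectivity onto the walks through `e`) and the resulting
exact identity with the occupation number `N_S(Ω)`; anything metric or asymptotic.
-/

noncomputable section

namespace Summit.CriticalPhenomena.SAWScalingLimit.Theorems.MassRatio.Occupation

open Literature.Probability.LatticeModels Literature.Probability.RandomPlanarGeometry
open Literature.Probability.RandomPlanarGeometry.SAW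
open Summit.CriticalPhenomena.SAWScalingLimit.Theorems.MassRatio.Negative

variable {Λ : Finset HexVertex} {a b e : Sym2 HexVertex}

/-! ### Endpoints of walks -/

/-- A walk between distinct mid-edges is nonempty. [folklore] -/
theorem verts_ne_nil_of_ne (γ : HexMidEdgeSAW Λ a e) (h : a ≠ e) : γ.verts ≠ [] :=
  fun h0 => h (γ.eq_of_nil h0)

/-- The last vertex of a nonempty walk `a → e` lies on `e`. [folklore] -/
theorem getLast_mem_end (γ : HexMidEdgeSAW Λ a e) (hne : γ.verts ≠ []) :
    γ.verts.getLast hne ∈ e :=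
  γ.getLast_mem _ (List.getLast?_eq_some_getLast hne)

/-- The first vertex of a nonempty walk `e → b` lies on `e`. [folklore] -/
theorem head_mem_start (ω : HexMidEdgeSAW Λ e b) (hne : ω.verts ≠ []) :
    ω.verts.head hne ∈ e :=
  ω.head_mem _ (List.head?_eq_some_head hne)

/-- A walk of the slit domain `Λ ∖ γ` avoids the vertices of `γ`. [folklore] -/
theorem not_mem_of_mem_slit {γl : List HexVertex} (ω : HexMidEdgeSAW (Λ \ γl.toFinset) e b)
    {v : HexVertex} (hv : v ∈ ω.verts) : v ∉ γl :=
  fun h => (Finset.mem_sdiff.1 (ω.subset v hv)).2 (List.mem_toFinset.2 h)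

/-- A walk of the slit domain `Λ ∖ γ` stays in `Λ`. [folklore] -/
theorem mem_of_mem_slit {γl : List HexVertex} (ω : HexMidEdgeSAW (Λ \ γl.toFinset) e b)
    {v : HexVertex} (hv : v ∈ ω.verts) : v ∈ Λ :=
  (Finset.mem_sdiff.1 (ω.subset v hv)).1

/-- **The cut point.** For a nonempty walk `γ : a → e` of `Λ` and a nonempty walk `ω : e → b` of the
slit domain `Λ ∖ γ`, the mid-edge `e` is `{last γ, head ω}`, and these two vertices are distinct and
adjacent. [folklore] -/
theorem cut_eq (γ : HexMidEdgeSAW Λ a e) (hγ : γ.verts ≠ [])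
    (ω : HexMidEdgeSAW (Λ \ γ.verts.toFinset) e b) (hω : ω.verts ≠ []) :
    γ.verts.getLast hγ ≠ ω.verts.head hω ∧ e = s(γ.verts.getLast hγ, ω.verts.head hω) ∧
      hexGraph.Adj (γ.verts.getLast hγ) (ω.verts.head hω) := by
  have hv : γ.verts.getLast hγ ∈ e := getLast_mem_end γ hγ
  have hw : ω.verts.head hω ∈ e := head_mem_start ω hω
  have hne : γ.verts.getLast hγ ≠ ω.verts.head hω := fun h =>
    not_mem_of_mem_slit ω (List.head_mem hω) (h ▸ List.getLast_mem hγ)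
  have he : e = s(γ.verts.getLast hγ, ω.verts.head hω) := (Sym2.mem_and_mem_iff hne).1 ⟨hv, hw⟩
  refine ⟨hne, he, ?_⟩
  have hE := ω.fst_mem.1
  rw [he] at hE
  exact (SimpleGraph.mem_edgeSet _).1 hE

/-! ### Gluing -/

/-- **Gluing, on vertex lists.** The list-level content of `glue`: a duplicate-free chain
`γl = l₁ ++ [v]` of `Λ` starting on `a` and a duplicate-free chain `ωl = w :: l₂` of `Λ` off `γl`
ending on the boundary mid-edge `s(u', v')` (`u' ∉ Λ`), with `e = {v, w}` an edge (`v ≠ w`) and the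
edge lists `a, pairs(γl), e` and `e, pairs(ωl), s(u', v')` duplicate-free, concatenate to the vertex
list of a self-avoiding walk `a → s(u', v')` of `Λ`. [folklore] -/
theorem glue_of_lists {u' v' v w : HexVertex} (hu' : u' ∉ Λ) {γl ωl l₁ l₂ : List HexVertex}
    (hγeq : γl = l₁ ++ [v]) (hωeq : ωl = w :: l₂) (hve : v ∈ e) (hwe : w ∈ e) (hvw : v ≠ w)
    (heE : e ∈ hexGraph.edgeSet) (hγΛ : ∀ x ∈ γl, x ∈ Λ) (hωΛ : ∀ x ∈ ωl, x ∈ Λ)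
    (hωγ : ∀ x ∈ ωl, x ∉ γl) (hγnd : γl.Nodup) (hωnd : ωl.Nodup)
    (hγch : γl.IsChain hexGraph.Adj) (hωch : ωl.IsChain hexGraph.Adj)
    (hhead : ∀ x, γl.head? = some x → x ∈ a) (hlast : ∀ x, ωl.getLast? = some x → x ∈ s(u', v'))
    (hE : (a :: List.zipWith (fun x y => s(x, y)) γl γl.tail ++ [e]).Nodup)
    (hF : (e :: List.zipWith (fun x y => s(x, y)) ωl ωl.tail ++ [s(u', v')]).Nodup)
    (haM : a ∈ hexDomainMidEdges Λ) :
    ∃ Ω : HexMidEdgeSAW Λ a s(u', v'), Ω.verts = γl ++ ωl := by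
  obtain rfl : e = s(v, w) := (Sym2.mem_and_mem_iff hvw).1 ⟨hve, hwe⟩
  subst hγeq hωeq
  have hadj : hexGraph.Adj v w := (SimpleGraph.mem_edgeSet _).1 heE
  have hγne : l₁ ++ [v] ≠ [] := by simp
  have hωne : w :: l₂ ≠ [] := List.cons_ne_nil _ _
  refine ⟨⟨(l₁ ++ [v]) ++ w :: l₂, ?_, ?_, ?_, ?_, ?_, ?_, ?_, haM⟩, rfl⟩
  · -- subset
    intro x hx
    rcases List.mem_append.1 hx with hx | hx
    · exact hγΛ x hx
    · exact hωΛ x hx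
  · -- nodup: the two supports are disjoint
    exact List.nodup_append.2 ⟨hγnd, hωnd, fun x hx y hy hxy => hωγ y hy (hxy ▸ hx)⟩
  · -- chain: the junction is the edge `e`
    refine List.isChain_append.2 ⟨hγch, hωch, fun x hx y hy => ?_⟩
    rw [List.getLast?_concat, Option.mem_def, Option.some_inj] at hx
    rw [List.head?_cons, Option.mem_def, Option.some_inj] at hy
    subst hx hy
    exact hadj
  · -- starts on `a`
    intro x hx
    rw [List.head?_append, List.head?_eq_some_head hγne, Option.some_or] at hx
    exact hhead x (by rw [List.head?_eq_some_head hγne]; exact hx)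
  · -- ends on `b`
    intro x hx
    rw [List.getLast?_append, List.getLast?_eq_some_getLast hωne, Option.some_or] at hx
    exact hlast x (by rw [List.getLast?_eq_some_getLast hωne]; exact hx)
  · -- nonempty
    intro h0
    exact (hωne (List.append_eq_nil_iff.1 h0).2).elim
  · -- no edge twice
    intro _
    rw [List.append_assoc, List.singleton_append, Renewal.RenewalCut.edges_append_cons_cons]
    have key : ((a :: List.zipWith (fun x y => s(x, y)) (l₁ ++ [v]) (l₁ ++ [v]).tail) ++
        (s(v, w) :: List.zipWith (fun x y => s(x, y)) (w :: l₂) (w :: l₂).tail ++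
          [s(u', v')])).Nodup := by
      refine List.nodup_append.2 ⟨(List.nodup_append.1 hE).1, hF, ?_⟩
      intro f hf f' hf' hff
      subst hff
      -- every pair on the `γ` side has a vertex on `γ`
      obtain ⟨c, hcf, hcγ⟩ : ∃ c ∈ f, c ∈ l₁ ++ [v] := by
        rcases List.mem_cons.1 hf with hfa | hf
        · rw [hfa]
          exact ⟨_, hhead _ (List.head?_eq_some_head hγne), List.head_mem hγne⟩
        · exact ⟨_, Sym2.out_fst_mem f, forall_mem_of_mem_edges _ _ hf _ (Sym2.out_fst_mem f)⟩
      rcases List.mem_append.1 hf' with hf' | hf'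
      · rcases List.mem_cons.1 hf' with rfl | hf'
        · -- the junction pair `e`: excluded by `hE`
          exact (List.nodup_append.1 hE).2.2 _ hf _ (List.mem_singleton_self _) rfl
        · -- a pair of `ω`: both its vertices are on `ω`, `c` is on `γ`
          exact hωγ c (forall_mem_of_mem_edges _ _ hf' c hcf) hcγ
      · -- the final mid-edge `b = s(u', v')`: `u' ∉ Λ`, and `v'` is the last vertex of `ω`
        rw [List.mem_singleton] at hf'
        subst hf'
        rcases Sym2.mem_iff.1 hcf with rfl | rfl
        · exact hu' (hγΛ _ hcγ)
        · have hl : (w :: l₂).getLast hωne ∈ s(u', c) :=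
            hlast _ (List.getLast?_eq_some_getLast hωne)
          rcases Sym2.mem_iff.1 hl with h1 | h1
          · exact hu' (h1 ▸ hωΛ _ (List.getLast_mem hωne))
          · exact hωγ _ (List.getLast_mem hωne) (h1 ▸ hcγ)
    simpa only [List.cons_append, List.append_assoc] using key

/-- **Gluing (one-sided domain Markov property).** For a boundary mid-edge `b ∈ ∂Ω`, a nonempty
walk `γ ⊂ Ω : a → e` followed by a nonempty walk `ω : e → b` of the slit domain `Λ ∖ γ` is a
self-avoiding walk `a → b` of `Ω` with vertex list `γ.verts ++ ω.verts`: the supports are disjoint,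
the junction is the edge `e` itself, and no edge is used twice (every pair on the `γ` side contains
a vertex of `γ`, no pair on the `ω` side does, `b`'s outer endpoint being off `Λ`).
[cite: DuminilCopinSmirnov2012, §2 (walks between mid-edges; domain Markov property)] -/
theorem glue (hb : b ∈ hexDomainBoundary Λ) (γ : HexMidEdgeSAW Λ a e) (hγ : γ.verts ≠ [])
    (ω : HexMidEdgeSAW (Λ \ γ.verts.toFinset) e b) (hω : ω.verts ≠ []) :
    ∃ Ω : HexMidEdgeSAW Λ a b, Ω.verts = γ.verts ++ ω.verts := by
  obtain ⟨-, u', v', rfl, -, hu'⟩ := hb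
  obtain ⟨hvw, -, -⟩ := cut_eq γ hγ ω hω
  exact glue_of_lists hu' (List.dropLast_append_getLast hγ).symm (List.cons_head_tail hω).symm
    (getLast_mem_end γ hγ) (head_mem_start ω hω) hvw ω.fst_mem.1 γ.subset
    (fun x hx => mem_of_mem_slit ω hx) (fun x hx => not_mem_of_mem_slit ω hx) γ.nodup ω.nodup
    γ.isChain ω.isChain γ.head_mem ω.getLast_mem (γ.edges_nodup hγ) (ω.edges_nodup hω) γ.fst_mem

/-! ### Injectivity of the gluing at a fixed cut mid-edge -/

/-- One half of the injectivity: if `γ' = γ ++ c` and `ω = c ++ ω'` for two glued pairs at the same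
mid-edge `e`, then `c = []`. (Otherwise `last γ' = last c` is a vertex of `ω`, hence off `γ`, so it
is the endpoint `head ω` of `e = {last γ, head ω}`; then `head ω'`, the endpoint of `e` off `γ'`,
must be `last γ` — but it lies on `ω' ⊆ ω`, off `γ`.) [folklore] -/
theorem eq_nil_of_glue_eq (γ γ' : HexMidEdgeSAW Λ a e) (hγ : γ.verts ≠ []) (hγ' : γ'.verts ≠ [])
    (ω : HexMidEdgeSAW (Λ \ γ.verts.toFinset) e b) (hω : ω.verts ≠ [])
    (ω' : HexMidEdgeSAW (Λ \ γ'.verts.toFinset) e b) (hω' : ω'.verts ≠ [])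
    {c : List HexVertex} (h1 : γ'.verts = γ.verts ++ c) (h2 : ω.verts = c ++ ω'.verts) :
    c = [] := by
  by_contra hc
  obtain ⟨hvw, he, -⟩ := cut_eq γ hγ ω hω
  obtain ⟨hvw', he', -⟩ := cut_eq γ' hγ' ω' hω'
  -- `last γ' = last c ∈ ω.verts`, so it is off `γ`
  have hlast' : γ'.verts.getLast hγ' = c.getLast hc := by
    have h3 : γ'.verts.getLast? = some (c.getLast hc) := by
      rw [h1, List.getLast?_append, List.getLast?_eq_some_getLast hc, Option.some_or]
    have h4 := List.getLast?_eq_some_getLast hγ'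
    rw [h3, Option.some_inj] at h4
    exact h4.symm
  have hv'ω : γ'.verts.getLast hγ' ∈ ω.verts := by
    rw [hlast', h2]
    exact List.mem_append_left _ (List.getLast_mem hc)
  have hv'γ : γ'.verts.getLast hγ' ∉ γ.verts := not_mem_of_mem_slit ω hv'ω
  -- `head ω' ∈ ω'.verts ⊆ ω.verts`, so it is off `γ` too
  have hw'ω : ω'.verts.head hω' ∈ ω.verts := by
    rw [h2]
    exact List.mem_append_right _ (List.head_mem hω')
  have hw'γ : ω'.verts.head hω' ∉ γ.verts := not_mem_of_mem_slit ω hw'ω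
  -- but `e = {last γ, head ω}` with `last γ ∈ γ.verts`: both endpoints of `e` read off the second
  -- pair would then be `head ω`, contradicting `last γ' ≠ head ω'`
  have key : ∀ x ∈ e, x = γ.verts.getLast hγ ∨ x = ω.verts.head hω := by
    intro x hx
    rw [he] at hx
    exact Sym2.mem_iff.1 hx
  have hvγ : γ.verts.getLast hγ ∈ γ.verts := List.getLast_mem hγ
  rcases key _ (getLast_mem_end γ' hγ') with h3 | h3
  · exact hv'γ (h3 ▸ hvγ)
  rcases key _ (head_mem_start ω' hω') with h4 | h4
  · exact hw'γ (h4 ▸ hvγ)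
  exact hvw' (h3.trans h4.symm)

/-- **Injectivity of the gluing at a fixed mid-edge `e`.** If `γ.verts ++ ω.verts = γ'.verts ++ ω'.verts`
for two glued pairs at `e`, then `γ = γ'` and the continuations have the same vertex list. [folklore] -/
theorem glue_inj (γ γ' : HexMidEdgeSAW Λ a e) (hγ : γ.verts ≠ []) (hγ' : γ'.verts ≠ [])
    (ω : HexMidEdgeSAW (Λ \ γ.verts.toFinset) e b) (hω : ω.verts ≠ [])
    (ω' : HexMidEdgeSAW (Λ \ γ'.verts.toFinset) e b) (hω' : ω'.verts ≠ [])
    (heq : γ.verts ++ ω.verts = γ'.verts ++ ω'.verts) :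
    γ.verts = γ'.verts ∧ ω.verts = ω'.verts := by
  rcases List.append_eq_append_iff.1 heq with ⟨c, h1, h2⟩ | ⟨c, h1, h2⟩
  · have hc := eq_nil_of_glue_eq γ γ' hγ hγ' ω hω ω' hω' h1 h2
    subst hc
    rw [List.append_nil] at h1
    rw [List.nil_append] at h2
    exact ⟨h1.symm, h2⟩
  · have hc := eq_nil_of_glue_eq γ' γ hγ' hγ ω' hω' ω hω h1 h2
    subst hc
    rw [List.append_nil] at h1
    rw [List.nil_append] at h2
    exact ⟨h1, h2.symm⟩

/-! ### The occupation inequality -/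

/-- **The factorised mass through `e` is at most the mass `a → b`.** For boundary mid-edges
`a, b ∈ ∂Ω`, a mid-edge `e ≠ a, b` and `x ≥ 0`:
`Σ_{γ ⊂ Ω : a → e} x^{ℓ(γ)} · Σ_{ω ⊂ Ω∖γ : e → b} x^{ℓ(ω)} ≤ Σ_{Ω ⊂ Ω : a → b} x^{ℓ(Ω)}`
(glue each pair; the gluing is injective and length-additive).
[cite: DuminilCopinSmirnov2012, §2 (domain Markov property)] -/
theorem sum_mul_sum_slit_le (hb : b ∈ hexDomainBoundary Λ) (hea : e ≠ a) (heb : e ≠ b)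
    {x : ℝ} (hx : 0 ≤ x) :
    ∑ γ : HexMidEdgeSAW Λ a e, x ^ γ.length *
        ∑ ω : HexMidEdgeSAW (Λ \ γ.verts.toFinset) e b, x ^ ω.length ≤
      ∑ Ω : HexMidEdgeSAW Λ a b, x ^ Ω.length := by
  classical
  have hγne : ∀ γ : HexMidEdgeSAW Λ a e, γ.verts ≠ [] := fun γ =>
    verts_ne_nil_of_ne γ (Ne.symm hea)
  have hωne : ∀ (γ : HexMidEdgeSAW Λ a e) (ω : HexMidEdgeSAW (Λ \ γ.verts.toFinset) e b),
      ω.verts ≠ [] := fun γ ω => verts_ne_nil_of_ne ω heb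
  calc ∑ γ : HexMidEdgeSAW Λ a e, x ^ γ.length *
          ∑ ω : HexMidEdgeSAW (Λ \ γ.verts.toFinset) e b, x ^ ω.length
      = ∑ p : (Σ γ : HexMidEdgeSAW Λ a e, HexMidEdgeSAW (Λ \ γ.verts.toFinset) e b),
          x ^ (p.1.verts ++ p.2.verts).length := by
        rw [Fintype.sum_sigma]
        refine Finset.sum_congr rfl fun γ _ => ?_
        rw [Finset.mul_sum]
        refine Finset.sum_congr rfl fun ω _ => ?_
        rw [List.length_append, pow_add]
        rfl
    _ ≤ ∑ l ∈ (Finset.univ : Finset (HexMidEdgeSAW Λ a b)).image HexMidEdgeSAW.verts,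
          x ^ l.length := by
        refine HV.sum_le_sum_of_injOn_of_nonneg
          (fun p : (Σ γ : HexMidEdgeSAW Λ a e, HexMidEdgeSAW (Λ \ γ.verts.toFinset) e b) =>
            p.1.verts ++ p.2.verts) ?_ ?_ (fun l : List HexVertex => x ^ l.length)
          (fun _ _ => pow_nonneg hx _)
        · -- injectivity: `glue_inj`
          rintro ⟨γ, ω⟩ - ⟨γ', ω'⟩ - heq
          dsimp only at heq
          obtain ⟨h1, h2⟩ := glue_inj γ γ' (hγne γ) (hγne γ') ω (hωne γ ω) ω' (hωne γ' ω') heq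
          obtain rfl : γ = γ' := HexMidEdgeSAW.ext h1
          obtain rfl : ω = ω' := HexMidEdgeSAW.ext h2
          rfl
        · -- the glued list is a walk `a → b` of `Λ`: `glue`
          rintro ⟨γ, ω⟩ -
          obtain ⟨Ω, hΩ⟩ := glue hb γ (hγne γ) ω (hωne γ ω)
          exact Finset.mem_image.2 ⟨Ω, Finset.mem_univ _, hΩ⟩
    _ = ∑ Ω : HexMidEdgeSAW Λ a b, x ^ Ω.length := by
        rw [Finset.sum_image fun γ _ γ' _ h => HexMidEdgeSAW.ext h]
        rfl

/-- **The occupation inequality, summed over a finite set of mid-edges.** For boundary mid-edges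
`a, b ∈ ∂Ω`, a finite set `S` of mid-edges avoiding `a` and `b`, and `x ≥ 0`:
`Σ_{e ∈ S} Σ_{γ ⊂ Ω : a → e} x^{ℓ(γ)} · Σ_{ω ⊂ Ω∖γ : e → b} x^{ℓ(ω)} ≤ |S| · Σ_{Ω ⊂ Ω : a → b} x^{ℓ(Ω)}`
(each walk `a → b` is produced at most once per mid-edge of `S`).
[cite: DuminilCopinSmirnov2012, §2 (domain Markov property)] -/
theorem sum_sum_mul_sum_slit_le_card_mul (hb : b ∈ hexDomainBoundary Λ)
    (S : Finset (Sym2 HexVertex)) (haS : a ∉ S) (hbS : b ∉ S) {x : ℝ} (hx : 0 ≤ x) :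
    ∑ e ∈ S, ∑ γ : HexMidEdgeSAW Λ a e, x ^ γ.length *
        ∑ ω : HexMidEdgeSAW (Λ \ γ.verts.toFinset) e b, x ^ ω.length ≤
      S.card * ∑ Ω : HexMidEdgeSAW Λ a b, x ^ Ω.length := by
  calc ∑ e ∈ S, ∑ γ : HexMidEdgeSAW Λ a e, x ^ γ.length *
          ∑ ω : HexMidEdgeSAW (Λ \ γ.verts.toFinset) e b, x ^ ω.length
      ≤ ∑ e ∈ S, ∑ Ω : HexMidEdgeSAW Λ a b, x ^ Ω.length :=
        Finset.sum_le_sum fun e he =>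
          sum_mul_sum_slit_le hb (ne_of_mem_of_not_mem he haS) (ne_of_mem_of_not_mem he hbS) hx
    _ = S.card * ∑ Ω : HexMidEdgeSAW Λ a b, x ^ Ω.length := by
        rw [Finset.sum_const, nsmul_eq_mul]

/-- **The occupation inequality for the spin-`0` parafermionic observable** (`Z = ‖F_{x,0}‖`, the
`x`-weighted two-point mass): for boundary mid-edges `a, b ∈ ∂Ω`, a finite set `S` of mid-edges
avoiding `a` and `b`, and `x ≥ 0`,
`Σ_{e ∈ S} Σ_{γ ⊂ Ω : a → e} x^{ℓ(γ)} ‖F^{Λ∖γ}_{x,0}(e → b)‖ ≤ |S| · ‖F^{Λ}_{x,0}(a → b)‖` — the mass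
of the walks from `a` into `S`, each weighted by the continuation mass from its tip mid-edge to `b`
in its own slit domain, is at most `|S|` times the boundary-to-boundary mass `Z_Λ(a → b)`.
[cite: DuminilCopinSmirnov2012, §2 (domain Markov property)] -/
theorem occupation_le_card_mul_norm : ∀ (Λ : Finset HexVertex) (a b : Sym2 HexVertex), b ∈ hexDomainBoundary Λ → ∀ (S : Finset (Sym2 HexVertex)), a ∉ S → b ∉ S → ∀ (x : ℝ), 0 ≤ x → ∑ e ∈ S, ∑ γ : HexMidEdgeSAW Λ a e, x ^ γ.length * ‖hexParafermionicObservable (Λ \ γ.verts.toFinset) e x 0 b‖ ≤ S.card * ‖hexParafermionicObservable Λ a x 0 b‖ := by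
  intro Λ a b hb S haS hbS x hx
  rw [norm_Z_eq_sum _ _ _ hx]
  refine le_of_eq_of_le (Finset.sum_congr rfl fun e _ => Finset.sum_congr rfl fun γ _ => ?_)
    (sum_sum_mul_sum_slit_le_card_mul hb S haS hbS hx)
  rw [norm_Z_eq_sum _ _ _ hx]

end Summit.CriticalPhenomena.SAWScalingLimit.Theorems.MassRatio.Occupation
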